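import Summits.CriticalPhenomena.PercolationContinuityZ3.Theorems.PercNearOneGluingNoHeavyQuantThreeRootAtomicRegating
import HarnessLib

/-!
# QUANT lane R8, T-DEC: THE ATOMIC RE-GATING STEP — a gated three-tree sibling group is DEC at every layer for every outer gate
# `a ≤ Σqᵢrᵢ/ΣqᵢRᵢ`, by the kernel slice theorems (sequel of `…QuantThreeRootAtomicRegating`)

builds on p205010 (kernel theorem, internal audit signed; external expert review pending)

Support file (`--supports stmt-CriticalPhenomena-4575`), QUANT lane seat prim-quant-arm-1 (gen 46, architect); memo
`run/shared/lean/prim/quant/prim-quant-arm-1-g46/ARCH-LIGHT-G46.md` §10.  Theorems only, standard axioms, no sorries.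

THE STEP (`decAt_threeRoot_atomic`).  Boxes `tᵢ = gate_{qᵢ}ρᵢ` with `ρᵢ` probability laws on `{0..Mᵢ}` without an atom at `0`, root gates
`x ≤ qᵢ ≤ 1` (`0 < x < 1`), outer gate `a > 0`, `S = a(q₁R₁+q₂R₂+q₃R₃)`.  If every charged atom triple has `q₁m₁+q₂m₂+q₃m₃ ≥ S` (i.e.
`a ≤ Σqᵢrᵢ/ΣqᵢRᵢ`, `rᵢ` the least atoms; for 2-chain siblings this bound is ≥ 1/2) and `z·(q₁M₁+q₂M₂+q₃M₃) ≤ S·x`, `0 < z`, then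
`gate_a(t₁ ∗ t₂ ∗ t₃)` is DEC(j) at floor `z` at EVERY layer `j`: by `threeRoot_atomic_regate` it is a finite mixture of gated blob triples
of mean `S`, each DEC at the common target by `decAtT_gate_blob3` — three applications of `sdec_slice_blob_of_mixLaw'` (+ Theorem A above the
top, `decAt_gate_of_top_le`) — and `decAtT_mixture_finset` closes.  `GatedSliceMixLaw'` is a hypothesis, fed by ✓ `gatedSliceMixLaw'_holds`.
No SDEC hypothesis on any composite forest is used: inside `LawDec.GateStepN` this sub-family of the width-3 core is free WITHOUT the oracle.

HONEST STATUS.  `GateStepN`, `GateStepNCore`, `FarTreeRow` remain OPEN; RATE class (log\*) and the honest sentence of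
`run/shared/lean/prim/quant/README.md` unchanged.  [this work]; slice theorems: this lane.  Nothing here is a published result.  The gluing
rows served [cite: KozmaNitzan2024, Conjecture 3 (p. 15)]; product measure [cite: Grimmett1999, §1.3 p. 10].
-/

noncomputable section

namespace Summit.CriticalPhenomena.PercolationContinuityZ3.Theorems

namespace Quant

open Finset

namespace LawDec

/-- the point mass at `m` (notation only). -/
local notation3 "δ[" m "]" => (fun h : ℕ => if h = m then (1 : ℝ) else 0)

/-! ### The DEC consequence: every component is a gated blob sibling group -/

/-- `gate δ_m q` is the one-blob slice of `δ₀`. [this work] -/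
theorem gate_point_eq_slice (m : ℕ) (q : ℝ) : gate δ[m] q = slice δ[0] m q := by
  funext h
  simp only [gate_apply, slice]
  split_ifs <;> (first | (exfalso; omega) | ring)

/-- `gate δ_m q` as the two-point law `{0, m; q}` (the `TP` shape of `slice_eq_lconv_blob`). [this work] -/
theorem gate_point_eq_TP (m : ℕ) (q : ℝ) :
    gate δ[m] q = fun k => q * (if k = m then (1 : ℝ) else 0) + (1 - q) * (if k = 0 then (1 : ℝ) else 0) := by
  funext k; simp only [gate_apply]

/-- **THE GATED BLOB TRIPLE IS DEC AT EVERY LAYER** (slice theorems ×3, then the root gate): for blob sizes `1 ≤ mᵢ ≤ Mᵢ`, gates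
`x ≤ qᵢ ≤ 1` (`0 < x < 1`), a root gate `0 < g ≤ 1` and a floor `z ≤ g·x`, the law `gate_g(gate_{q₁}δ_{m₁} ∗ gate_{q₂}δ_{m₂} ∗ gate_{q₃}δ_{m₃})`
(written with the tops `Mᵢ`) is DEC(j) at floor `z`, target `g(q₁m₁+q₂m₂+q₃m₃)`, on `{0..M₁+M₂+M₃}`, for every `j`. [this work] -/
theorem decAtT_gate_blob3 (hL : GatedSliceMixLaw') (x z g q₁ q₂ q₃ : ℝ) (M₁ M₂ M₃ m₁ m₂ m₃ : ℕ)
    (hx0 : 0 < x) (hx1 : x < 1) (hxq₁ : x ≤ q₁) (hq₁1 : q₁ ≤ 1) (hxq₂ : x ≤ q₂) (hq₂1 : q₂ ≤ 1) (hxq₃ : x ≤ q₃) (hq₃1 : q₃ ≤ 1)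
    (hg0 : 0 < g) (hg1 : g ≤ 1) (hz : z ≤ g * x)
    (hm₁ : 1 ≤ m₁) (hm₁M : m₁ ≤ M₁) (hm₂ : 1 ≤ m₂) (hm₂M : m₂ ≤ M₂) (hm₃ : 1 ≤ m₃) (hm₃M : m₃ ≤ M₃) (j : ℕ) :
    DECAtT z (g * (q₁ * (m₁ : ℝ) + q₂ * (m₂ : ℝ) + q₃ * (m₃ : ℝ))) j (M₁ + M₂ + M₃)
      (gate (lconv (M₁ + M₂) M₃ (lconv M₁ M₂ (gate δ[m₁] q₁) (gate δ[m₂] q₂)) (gate δ[m₃] q₃)) g) := by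
  -- right-top flexibility of `lconv` (the left version is `lconv_top_left_of_le`; the right one is in `…QuantForestData`, not imported here)
  have ltr : ∀ (N₁ N₂ N₂' : ℕ) (μ ν : ℕ → ℝ), N₂ ≤ N₂' → (∀ h, N₂ < h → ν h = 0) → ∀ h, lconv N₁ N₂' μ ν h = lconv N₁ N₂ μ ν h := by
    intro N₁ N₂ N₂' μ ν hN hν h
    rw [lconv_comm N₁ N₂', lconv_comm N₁ N₂]
    exact lconv_top_left_of_le N₂ N₂' N₁ ν μ hN hν h
  -- δ₀ and its law facts
  have d0 : ∀ h, 0 ≤ δ[0] h := fun h => by dsimp only; split_ifs <;> norm_num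
  have dM : ∀ h, 0 < h → δ[0] h = 0 := fun h hh => by dsimp only; rw [if_neg (by omega)]
  have d1 : ∑ h ∈ Finset.range (0 + 1), δ[0] h = 1 := by simp
  have dta : x * ((0 : ℕ) : ℝ) ≤ ∑ h ∈ Finset.range (0 + 1), (h : ℝ) * δ[0] h := by simp
  have dS : SDEC x 0 δ[0] := fun _ _ _ j' hj' => absurd hj' (Nat.not_lt_zero j')
  -- first blob
  set B₁ : ℕ → ℝ := slice δ[0] m₁ q₁ with hB₁
  have s₁ : SDEC x (0 + m₁) B₁ := sdec_slice_blob_of_mixLaw' hL x q₁ 0 m₁ δ[0] hx0 hx1 hxq₁ hq₁1 hm₁ d0 dM d1 dta dS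
  rw [Nat.zero_add] at s₁
  have b₁0 : ∀ h, 0 ≤ B₁ h := slice_nonneg _ _ _ (hx0.le.trans hxq₁) hq₁1 d0
  have b₁M : ∀ h, m₁ < h → B₁ h = 0 := fun h hh => slice_eq_zero _ _ _ 0 dM h (by omega)
  have b₁1 : ∑ h ∈ Finset.range (m₁ + 1), B₁ h = 1 := by
    have := sum_slice δ[0] m₁ q₁ 0 dM d1; rwa [Nat.zero_add] at this
  have b₁mean : ∑ h ∈ Finset.range (m₁ + 1), (h : ℝ) * B₁ h = q₁ * (m₁ : ℝ) := by
    have := sum_mul_slice δ[0] m₁ q₁ 0 dM d1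
    rw [Nat.zero_add] at this; rw [this]; simp; ring
  have b₁ta : x * (m₁ : ℝ) ≤ ∑ h ∈ Finset.range (m₁ + 1), (h : ℝ) * B₁ h := by
    rw [b₁mean]; exact mul_le_mul_of_nonneg_right hxq₁ (Nat.cast_nonneg _)
  -- second blob
  set B₂ : ℕ → ℝ := slice B₁ m₂ q₂ with hB₂
  have s₂ : SDEC x (m₁ + m₂) B₂ := sdec_slice_blob_of_mixLaw' hL x q₂ m₁ m₂ B₁ hx0 hx1 hxq₂ hq₂1 hm₂ b₁0 b₁M b₁1 b₁ta s₁
  have b₂0 : ∀ h, 0 ≤ B₂ h := slice_nonneg _ _ _ (hx0.le.trans hxq₂) hq₂1 b₁0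
  have b₂M : ∀ h, m₁ + m₂ < h → B₂ h = 0 := fun h hh => slice_eq_zero _ _ _ m₁ b₁M h hh
  have b₂1 : ∑ h ∈ Finset.range (m₁ + m₂ + 1), B₂ h = 1 := sum_slice B₁ m₂ q₂ m₁ b₁M b₁1
  have b₂mean : ∑ h ∈ Finset.range (m₁ + m₂ + 1), (h : ℝ) * B₂ h = q₁ * (m₁ : ℝ) + q₂ * (m₂ : ℝ) := by
    rw [hB₂, sum_mul_slice B₁ m₂ q₂ m₁ b₁M b₁1, b₁mean]; ring
  have b₂ta : x * ((m₁ + m₂ : ℕ) : ℝ) ≤ ∑ h ∈ Finset.range (m₁ + m₂ + 1), (h : ℝ) * B₂ h := by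
    rw [b₂mean]; push_cast
    nlinarith [mul_le_mul_of_nonneg_right hxq₁ (Nat.cast_nonneg m₁), mul_le_mul_of_nonneg_right hxq₂ (Nat.cast_nonneg m₂)]
  -- third blob
  set B₃ : ℕ → ℝ := slice B₂ m₃ q₃ with hB₃
  have s₃ : SDEC x (m₁ + m₂ + m₃) B₃ := sdec_slice_blob_of_mixLaw' hL x q₃ (m₁ + m₂) m₃ B₂ hx0 hx1 hxq₃ hq₃1 hm₃ b₂0 b₂M b₂1 b₂ta s₂
  have b₃0 : ∀ h, 0 ≤ B₃ h := slice_nonneg _ _ _ (hx0.le.trans hxq₃) hq₃1 b₂0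
  have b₃M : ∀ h, m₁ + m₂ + m₃ < h → B₃ h = 0 := fun h hh => slice_eq_zero _ _ _ (m₁ + m₂) b₂M h hh
  have b₃1 : ∑ h ∈ Finset.range (m₁ + m₂ + m₃ + 1), B₃ h = 1 := sum_slice B₂ m₃ q₃ (m₁ + m₂) b₂M b₂1
  have b₃mean : ∑ h ∈ Finset.range (m₁ + m₂ + m₃ + 1), (h : ℝ) * B₃ h = q₁ * (m₁ : ℝ) + q₂ * (m₂ : ℝ) + q₃ * (m₃ : ℝ) := by
    rw [hB₃, sum_mul_slice B₂ m₃ q₃ (m₁ + m₂) b₂M b₂1, b₂mean]; ring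
  have b₃ta : x * ((m₁ + m₂ + m₃ : ℕ) : ℝ) ≤ ∑ h ∈ Finset.range (m₁ + m₂ + m₃ + 1), (h : ℝ) * B₃ h := by
    rw [b₃mean]; push_cast
    nlinarith [mul_le_mul_of_nonneg_right hxq₁ (Nat.cast_nonneg m₁), mul_le_mul_of_nonneg_right hxq₂ (Nat.cast_nonneg m₂),
      mul_le_mul_of_nonneg_right hxq₃ (Nat.cast_nonneg m₃)]
  -- the gated triple at every layer, floor z ≤ g·x
  have hgx1 : g * x < 1 := by
    have : g * x ≤ 1 * x := mul_le_mul_of_nonneg_right hg1 hx0.le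
    linarith
  have d : DECAtT z (g * (q₁ * (m₁ : ℝ) + q₂ * (m₂ : ℝ) + q₃ * (m₃ : ℝ))) j (m₁ + m₂ + m₃) (gate B₃ g) := by
    have dd : DECAt (g * x) j (m₁ + m₂ + m₃) (gate B₃ g) := by
      by_cases hjM : j < m₁ + m₂ + m₃
      · exact s₃ g hg0 hg1 j hjM
      · exact decAt_gate_of_top_le (m₁ + m₂ + m₃) B₃ x g hx0.le hgx1 hg0.le hg1 b₃0 b₃M b₃1 b₃ta j (not_lt.1 hjM)
    have dd' := decAt_mono_floor hz hgx1 dd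
    rwa [decAt_iff_decAtT, sum_mul_gate, b₃mean] at dd'
  -- identify the law: tops `Mᵢ` versus the slices
  have eB : gate (lconv (M₁ + M₂) M₃ (lconv M₁ M₂ (gate δ[m₁] q₁) (gate δ[m₂] q₂)) (gate δ[m₃] q₃)) g = gate B₃ g := by
    have gM : ∀ (m M : ℕ) (q : ℝ), m ≤ M → ∀ h, m < h → gate δ[m] q h = 0 := by
      intro m M q _ h hh; simp only [gate_apply]; rw [if_neg (by omega), if_neg (by omega)]; ring
    have e12 : lconv M₁ M₂ (gate δ[m₁] q₁) (gate δ[m₂] q₂) = B₂ := by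
      funext k
      rw [lconv_top_left_of_le m₁ M₁ M₂ _ _ hm₁M (gM m₁ M₁ q₁ hm₁M) k, ltr m₁ m₂ M₂ _ _ hm₂M (gM m₂ M₂ q₂ hm₂M) k,
        hB₂, ← slice_eq_lconv_blob B₁ m₁ m₂ q₂ b₁M, hB₁, ← gate_point_eq_slice m₁ q₁, gate_point_eq_TP m₂ q₂]
    have e123 : lconv (M₁ + M₂) M₃ (lconv M₁ M₂ (gate δ[m₁] q₁) (gate δ[m₂] q₂)) (gate δ[m₃] q₃) = B₃ := by
      funext k
      rw [e12, lconv_top_left_of_le (m₁ + m₂) (M₁ + M₂) M₃ _ _ (by omega) b₂M k,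
        ltr (m₁ + m₂) m₃ M₃ _ _ hm₃M (gM m₃ M₃ q₃ hm₃M) k, hB₃, ← slice_eq_lconv_blob B₂ (m₁ + m₂) m₃ q₃ b₂M,
        gate_point_eq_TP m₃ q₃]
    rw [e123]
  rw [eB]
  exact decAtT_mono_top d (by omega)

/-- **THE ATOMIC RE-GATING STEP: DEC of a gated three-tree sibling group for every outer gate `a` with `a·ΣqᵢRᵢ ≤ Σqᵢmᵢ` on all charged
atom triples** (in particular for every `a ≤ Σqᵢrᵢ/ΣqᵢRᵢ`, `rᵢ` the least atoms).  Data: probability laws `ρᵢ` on `{0..Mᵢ}` with no atom at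
`0` and means `Rᵢ`; root gates `x ≤ qᵢ ≤ 1` (`0 < x < 1`); `0 < a ≤ 1`; a floor `0 < z` with `z·(q₁M₁+q₂M₂+q₃M₃) ≤ a(ΣqᵢRᵢ)·x`.  Conclusion:
`gate_a(∏ gate_{qᵢ}ρᵢ)` is DEC(j) at floor `z` at EVERY layer `j` (no upper bound on `a` other than the atom condition is used) — a finite mixture (`threeRoot_atomic_regate`) of gated blob triples,
each DEC at the common target by `decAtT_gate_blob3` (the kernel slice theorems; `GatedSliceMixLaw'` is ✓ `gatedSliceMixLaw'_holds`). [this work] -/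
theorem decAt_threeRoot_atomic (hL : GatedSliceMixLaw') (x z a q₁ q₂ q₃ R₁ R₂ R₃ : ℝ) (M₁ M₂ M₃ : ℕ) (ρ₁ ρ₂ ρ₃ : ℕ → ℝ)
    (hx0 : 0 < x) (hx1 : x < 1) (hxq₁ : x ≤ q₁) (hq₁1 : q₁ ≤ 1) (hxq₂ : x ≤ q₂) (hq₂1 : q₂ ≤ 1) (hxq₃ : x ≤ q₃) (hq₃1 : q₃ ≤ 1)
    (ha0 : 0 < a) (hz0 : 0 < z)
    (h₁0' : ∀ h, 0 ≤ ρ₁ h) (h₁M : ∀ h, M₁ < h → ρ₁ h = 0) (h₁1 : ∑ h ∈ Finset.range (M₁ + 1), ρ₁ h = 1)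
    (hR₁ : ∑ h ∈ Finset.range (M₁ + 1), (h : ℝ) * ρ₁ h = R₁) (h₁0 : ρ₁ 0 = 0)
    (h₂0' : ∀ h, 0 ≤ ρ₂ h) (h₂M : ∀ h, M₂ < h → ρ₂ h = 0) (h₂1 : ∑ h ∈ Finset.range (M₂ + 1), ρ₂ h = 1)
    (hR₂ : ∑ h ∈ Finset.range (M₂ + 1), (h : ℝ) * ρ₂ h = R₂) (h₂0 : ρ₂ 0 = 0)
    (h₃0' : ∀ h, 0 ≤ ρ₃ h) (h₃M : ∀ h, M₃ < h → ρ₃ h = 0) (h₃1 : ∑ h ∈ Finset.range (M₃ + 1), ρ₃ h = 1)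
    (hR₃ : ∑ h ∈ Finset.range (M₃ + 1), (h : ℝ) * ρ₃ h = R₃) (h₃0 : ρ₃ 0 = 0)
    (hcond : ∀ m₁ m₂ m₃, 0 < ρ₁ m₁ → 0 < ρ₂ m₂ → 0 < ρ₃ m₃ →
      a * (q₁ * R₁ + q₂ * R₂ + q₃ * R₃) ≤ q₁ * (m₁ : ℝ) + q₂ * (m₂ : ℝ) + q₃ * (m₃ : ℝ))
    (hz : z * (q₁ * (M₁ : ℝ) + q₂ * (M₂ : ℝ) + q₃ * (M₃ : ℝ)) ≤ a * (q₁ * R₁ + q₂ * R₂ + q₃ * R₃) * x) (j : ℕ) :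
    DECAt z j (M₁ + M₂ + M₃) (gate (lconv (M₁ + M₂) M₃ (lconv M₁ M₂ (gate ρ₁ q₁) (gate ρ₂ q₂)) (gate ρ₃ q₃)) a) := by
  have hq₁0 : 0 < q₁ := lt_of_lt_of_le hx0 hxq₁
  have hq₂0 : 0 < q₂ := lt_of_lt_of_le hx0 hxq₂
  have hq₃0 : 0 < q₃ := lt_of_lt_of_le hx0 hxq₃
  -- the means are positive (no atom at 0, mass 1)
  have Rpos : ∀ (M : ℕ) (ρ : ℕ → ℝ) (R : ℝ), (∀ h, 0 ≤ ρ h) → (∑ h ∈ Finset.range (M + 1), ρ h = 1) →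
      (∑ h ∈ Finset.range (M + 1), (h : ℝ) * ρ h = R) → ρ 0 = 0 → 1 ≤ R := by
    intro M ρ R h0 h1 hR hz0'
    rw [← hR, ← h1]
    refine Finset.sum_le_sum fun h hh => ?_
    rcases Nat.eq_zero_or_pos h with hzero | hpos
    · subst hzero; rw [hz0']; simp
    · have h1le : (1 : ℝ) ≤ (h : ℝ) := by exact_mod_cast hpos
      have := mul_le_mul_of_nonneg_right h1le (h0 h)
      linarith
  have hR₁1 := Rpos M₁ ρ₁ R₁ h₁0' h₁1 hR₁ h₁0
  have hR₂1 := Rpos M₂ ρ₂ R₂ h₂0' h₂1 hR₂ h₂0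
  have hR₃1 := Rpos M₃ ρ₃ R₃ h₃0' h₃1 hR₃ h₃0
  obtain ⟨S, hSdef⟩ : ∃ S : ℝ, S = a * (q₁ * R₁ + q₂ * R₂ + q₃ * R₃) := ⟨_, rfl⟩
  have hSpos : 0 < S := by
    rw [hSdef]
    have t1 : 0 < q₁ * R₁ := mul_pos hq₁0 (by linarith)
    have t2 : 0 < q₂ * R₂ := mul_pos hq₂0 (by linarith)
    have t3 : 0 < q₃ * R₃ := mul_pos hq₃0 (by linarith)
    exact mul_pos ha0 (by linarith)
  rw [← hSdef] at hcond hz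
  obtain ⟨s, hsdef⟩ : ∃ s : Finset (ℕ × (ℕ × ℕ)), s = Finset.range (M₃ + 1) ×ˢ (Finset.range (M₁ + 1) ×ˢ Finset.range (M₂ + 1)) :=
    ⟨_, rfl⟩
  -- weights, gates, laws of the components
  obtain ⟨w, hwdef⟩ : ∃ w : ℕ × (ℕ × ℕ) → ℝ, w = fun m =>
      a * (ρ₁ m.2.1 * ρ₂ m.2.2 * ρ₃ m.1) * (q₁ * (m.2.1 : ℝ) + q₂ * (m.2.2 : ℝ) + q₃ * (m.1 : ℝ)) / S := ⟨_, rfl⟩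
  obtain ⟨gg, hgdef⟩ : ∃ gg : ℕ × (ℕ × ℕ) → ℝ, gg = fun m => S / (q₁ * (m.2.1 : ℝ) + q₂ * (m.2.2 : ℝ) + q₃ * (m.1 : ℝ)) := ⟨_, rfl⟩
  obtain ⟨ν, hνdef⟩ : ∃ ν : ℕ × (ℕ × ℕ) → ℕ → ℝ, ν = fun m =>
      gate (lconv (M₁ + M₂) M₃ (lconv M₁ M₂ (gate δ[m.2.1] q₁) (gate δ[m.2.2] q₂)) (gate δ[m.1] q₃)) (gg m) :=
    ⟨_, rfl⟩
  -- the identity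
  have hid : ∀ h, gate (lconv (M₁ + M₂) M₃ (lconv M₁ M₂ (gate ρ₁ q₁) (gate ρ₂ q₂)) (gate ρ₃ q₃)) a h = ∑ m ∈ s, w m * ν m h := by
    intro h
    rw [hsdef, hwdef, hνdef, hgdef, hSdef]
    exact threeRoot_atomic_regate M₁ M₂ M₃ ρ₁ ρ₂ ρ₃ q₁ q₂ q₃ a R₁ R₂ R₃ h₁M h₂M h₃M h₁1 h₂1 h₃1 hR₁ hR₂ hR₃ h₁0 hq₁0 hq₂0 hq₃0
      (by rw [← hSdef]; exact hSpos.ne') h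
  -- weights: nonnegative, mass 1
  have hw0 : ∀ m ∈ s, 0 ≤ w m := by
    intro m _
    rw [hwdef]
    refine div_nonneg (mul_nonneg (mul_nonneg ha0.le (mul_nonneg (mul_nonneg (h₁0' _) (h₂0' _)) (h₃0' _))) ?_) hSpos.le
    have t1 := mul_nonneg hq₁0.le (Nat.cast_nonneg m.2.1)
    have t2 := mul_nonneg hq₂0.le (Nat.cast_nonneg m.2.2)
    have t3 := mul_nonneg hq₃0.le (Nat.cast_nonneg m.1)
    linarith
  have hw1 : ∑ m ∈ s, w m = 1 := by
    have e : ∀ m ∈ s, w m = (a / S) * (ρ₁ m.2.1 * ρ₂ m.2.2 * ρ₃ m.1 * (q₁ * (m.2.1 : ℝ) + q₂ * (m.2.2 : ℝ) + q₃ * (m.1 : ℝ))) := by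
      intro m _; rw [hwdef]; field_simp
    rw [Finset.sum_congr rfl e, ← Finset.mul_sum, hsdef, atomic_weights_mean M₁ M₂ M₃ ρ₁ ρ₂ ρ₃ q₁ q₂ q₃ h₁1 h₂1 h₃1, hR₁, hR₂, hR₃,
      div_mul_eq_mul_div, div_eq_one_iff_eq hSpos.ne', hSdef]
  -- every charged component is DEC at the common target
  have hdec : ∀ m ∈ s, 0 < w m → DECAtT z S j (M₁ + M₂ + M₃) (ν m) := by
    intro m hm hwm
    rw [hsdef] at hm
    obtain ⟨hm3, hm12⟩ := Finset.mem_product.1 hm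
    obtain ⟨hm1, hm2⟩ := Finset.mem_product.1 hm12
    rw [Finset.mem_range] at hm1 hm2 hm3
    -- a charged index has all three atoms charged
    have hc : 0 < ρ₁ m.2.1 * ρ₂ m.2.2 * ρ₃ m.1 := by
      by_contra hle
      have hz' : ρ₁ m.2.1 * ρ₂ m.2.2 * ρ₃ m.1 = 0 :=
        le_antisymm (not_lt.1 hle) (mul_nonneg (mul_nonneg (h₁0' _) (h₂0' _)) (h₃0' _))
      have : w m = 0 := by rw [hwdef]; dsimp only; rw [hz']; simp
      exact absurd this hwm.ne'
    have p1 : 0 < ρ₁ m.2.1 := by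
      rcases (h₁0' m.2.1).eq_or_lt with e | e
      · rw [← e, zero_mul, zero_mul] at hc; exact absurd hc (lt_irrefl 0)
      · exact e
    have p2 : 0 < ρ₂ m.2.2 := by
      rcases (h₂0' m.2.2).eq_or_lt with e | e
      · rw [← e, mul_zero, zero_mul] at hc; exact absurd hc (lt_irrefl 0)
      · exact e
    have p3 : 0 < ρ₃ m.1 := by
      rcases (h₃0' m.1).eq_or_lt with e | e
      · rw [← e, mul_zero] at hc; exact absurd hc (lt_irrefl 0)
      · exact e
    have n1 : 1 ≤ m.2.1 := by
      by_contra hlt; have : m.2.1 = 0 := by omega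
      rw [this, h₁0] at p1; exact absurd p1 (lt_irrefl 0)
    have n2 : 1 ≤ m.2.2 := by
      by_contra hlt; have : m.2.2 = 0 := by omega
      rw [this, h₂0] at p2; exact absurd p2 (lt_irrefl 0)
    have n3 : 1 ≤ m.1 := by
      by_contra hlt; have : m.1 = 0 := by omega
      rw [this, h₃0] at p3; exact absurd p3 (lt_irrefl 0)
    -- the root gate of this component lies in (0, 1]
    have hden : 0 < q₁ * (m.2.1 : ℝ) + q₂ * (m.2.2 : ℝ) + q₃ * (m.1 : ℝ) := by
      have : (1 : ℝ) ≤ (m.1 : ℝ) := by exact_mod_cast n3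
      have t1 := mul_nonneg hq₁0.le (Nat.cast_nonneg m.2.1)
      have t2 := mul_nonneg hq₂0.le (Nat.cast_nonneg m.2.2)
      nlinarith
    have hg0 : 0 < gg m := by rw [hgdef]; exact div_pos hSpos hden
    have hg1 : gg m ≤ 1 := by
      rw [hgdef]; dsimp only; rw [div_le_one hden]; exact hcond _ _ _ p1 p2 p3
    -- the floor: z ≤ g·x since g ≥ S/(q₁M₁+q₂M₂+q₃M₃)
    have hzg : z ≤ gg m * x := by
      rw [hgdef]; dsimp only
      rw [div_mul_eq_mul_div, le_div_iff₀ hden]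
      have hle : q₁ * (m.2.1 : ℝ) + q₂ * (m.2.2 : ℝ) + q₃ * (m.1 : ℝ) ≤ q₁ * (M₁ : ℝ) + q₂ * (M₂ : ℝ) + q₃ * (M₃ : ℝ) := by
        have c1 : (m.2.1 : ℝ) ≤ (M₁ : ℝ) := by exact_mod_cast (by omega : m.2.1 ≤ M₁)
        have c2 : (m.2.2 : ℝ) ≤ (M₂ : ℝ) := by exact_mod_cast (by omega : m.2.2 ≤ M₂)
        have c3 : (m.1 : ℝ) ≤ (M₃ : ℝ) := by exact_mod_cast (by omega : m.1 ≤ M₃)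
        have d1 := mul_le_mul_of_nonneg_left c1 hq₁0.le
        have d2 := mul_le_mul_of_nonneg_left c2 hq₂0.le
        have d3 := mul_le_mul_of_nonneg_left c3 hq₃0.le
        exact add_le_add (add_le_add d1 d2) d3
      exact le_trans (mul_le_mul_of_nonneg_left hle hz0.le) hz
    have d := decAtT_gate_blob3 hL x z (gg m) q₁ q₂ q₃ M₁ M₂ M₃ m.2.1 m.2.2 m.1 hx0 hx1 hxq₁ hq₁1 hxq₂ hq₂1 hxq₃ hq₃1 hg0 hg1 hzg
      n1 (by omega) n2 (by omega) n3 (by omega) j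
    have eS : gg m * (q₁ * (m.2.1 : ℝ) + q₂ * (m.2.2 : ℝ) + q₃ * (m.1 : ℝ)) = S := by
      rw [hgdef]; dsimp only; field_simp
    rw [eS] at d
    rw [hνdef]
    exact d
  have mix := decAtT_mixture_finset s w ν hw0 hw1 hdec
  -- the mean of the target
  obtain ⟨t₁0, t₁M, t₁1⟩ := gate_laws M₁ ρ₁ q₁ hq₁0.le hq₁1 h₁0' h₁M h₁1
  obtain ⟨t₂0, t₂M, t₂1⟩ := gate_laws M₂ ρ₂ q₂ hq₂0.le hq₂1 h₂0' h₂M h₂1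
  obtain ⟨t₃0, t₃M, t₃1⟩ := gate_laws M₃ ρ₃ q₃ hq₃0.le hq₃1 h₃0' h₃M h₃1
  have hEmean : ∑ h ∈ Finset.range (M₁ + M₂ + M₃ + 1), (h : ℝ) *
      gate (lconv (M₁ + M₂) M₃ (lconv M₁ M₂ (gate ρ₁ q₁) (gate ρ₂ q₂)) (gate ρ₃ q₃)) a h = S := by
    rw [sum_mul_gate, sum_mul_lconv (M₁ + M₂) M₃ _ _ (sum_lconv M₁ M₂ _ _ t₁1 t₂1) t₃1, sum_mul_lconv M₁ M₂ _ _ t₁1 t₂1,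
      sum_mul_gate, sum_mul_gate, sum_mul_gate, hR₁, hR₂, hR₃, hSdef]
  rw [decAt_iff_decAtT, hEmean]
  exact decAtT_congr (fun h => (hid h).symm) mix

end LawDec

end Quant

end Summit.CriticalPhenomena.PercolationContinuityZ3.Theorems
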